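import Literature.NumberTheory.EllipticCurves.ModularSymbolsManin
import HarnessLib

/-!
# Manin's presentation of `H₁(X₀(N), ℚ)` is EXACT: the kernel of the M-symbol map on cycles is the
# relation module (equality half of Manin 1972 Thm. 1.9 / Cremona 1997 Thm. 2.1.2, from the genus formula)

`ModularSymbolsManin` proves the INEQUALITY half of Manin's theorem — the M-symbol map
`Ψ = msymbolMap N : ℚ^X → S₂(Γ₀(N))^∧` (`X = SL(2, ℤ)/Γ₀(N)`) kills the relation module
`Rel = relModule N = range(1 + S^*) + range(1 + (TS)^* + (TS)^{*2})`, `Rel ⊆ ker δ` for the boundary map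
`δ = bdryMap N`, and the resulting rank bound `6 dim_ℚ ℚH + 3ε₂ + 4ε₃ + 6ε_∞ ≤ 12 + μ`
(`six_mul_finrank_span_periodHomology_le`). This file adds the EQUALITY
  `ker Ψ ⊓ ker δ = Rel`
(`ker_msymbolMap_inf_ker_bdryMap_eq_relModule`) granted the genus-cum-dimension formula
`twelve_mul_finrank_cuspForm_two (Gamma0 N)` (the named fact of `ModularCurveProofs`, Diamond–Shurman
Thm. 3.1.1 with Thm. 3.5.1): with `dim S₂(Γ₀(N)) = g` all the inequalities in Manin's count are equalities, so
the relation module has the full dimension of `ker(Ψ|_{ker δ})` and the inclusion `Rel ⊆ ker Ψ ⊓ ker δ` is an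
equality. This is Manin 1972, Thm. 1.9 (b) / Cremona 1997, Thm. 2.1.2 over `ℚ`: "`H(G) = Z(G)/B(G)` where
`B(G)` is spanned by the two- and three-term relations" — a rational cycle of M-symbols with zero periods IS a
rational combination of the two- and three-term relations. Also recorded: the image `Ψ(ker δ)` is exactly the
`ℚ`-span of the period homology (`map_ker_bdryMap_eq_span_periodHomology`).

Used by the `ℓ = 2` programme of crux `ThetaLayerLambdaCongruenceAtTwo` (line `birth`, ITEM B1): a `k`-valued
Manin-symbol system killing the relations and the `S`/`TS`-fixed cosets factors through the period lattice
(`Summits/…/Theorems/…ManinSymbolTorsion` supplies the integral/torsion half).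

References: [Manin1972] Thm. 1.9; [CremonaAlgorithms1997] §2.1 Thm. 2.1.2, §2.2; [DiamondShurman2005] Thm. 3.1.1,
Thm. 3.5.1, §6.1.
-/

noncomputable section

open scoped MatrixGroups ModularForm

open CongruenceSubgroup Matrix.SpecialLinearGroup ModularGroup

namespace Literature.NumberTheory.EllipticCurves.ModularForms

section Exact

open Module Submodule LinearMap
open scoped Classical

variable (N : ℕ) [NeZero N]

/-- **Manin's presentation is exact over `ℚ` (given the genus formula): `ker Ψ ⊓ ker δ = Rel`.** A rational chain
of M-symbols `c ∈ ℚ^X` with zero boundary (`δ c = 0`) and zero periods (`Ψ c = 0` in `S₂(Γ₀(N))^∧`) lies in the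
relation module spanned by the two-term and three-term relations. From Manin's rank count
(`six_mul_finrank_span_periodHomology_le` and its ingredients `finrank_relModule_ge`,
`card_cuspOrbits_le_finrank_range_bdryMap_add_one`, `periodHomology_le_map_ker`,
`two_mul_finrank_cuspForm_two_le_finrank_span_periodHomology`) all inequalities are forced to be equalities
by `12 dim S₂(Γ₀(N)) + 3ε₂ + 4ε₃ + 6ε_∞ = 12 + μ`. [cite: Manin1972, Thm. 1.9]
[cite: CremonaAlgorithms1997, §2.1 Thm. 2.1.2] -/
theorem ker_msymbolMap_inf_ker_bdryMap_eq_relModule (h₁ : twelve_mul_finrank_cuspForm_two (Gamma0 N)) :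
    LinearMap.ker (msymbolMap N) ⊓ LinearMap.ker (bdryMap N) = relModule N := by
  -- notation (as in `six_mul_finrank_span_periodHomology_le`)
  set U : Submodule ℚ (Gamma0Coset N → ℚ) := LinearMap.ker (bdryMap N) with hU
  set Ψ := msymbolMap N with hΨ
  have hμ : (Gamma0 N).index = Fintype.card (Gamma0Coset N) := by
    rw [Subgroup.index, Nat.card_eq_fintype_card]
  have hε₂ : Nat.card {q : SL(2, ℤ) ⧸ Gamma0 N // S • q = q} =
      (Finset.univ.filter fun q : Gamma0Coset N ↦ S • q = q).card := by
    rw [Nat.card_eq_fintype_card, Fintype.card_subtype]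
  have hε₃ : Nat.card {q : SL(2, ℤ) ⧸ Gamma0 N // (T * S) • q = q} =
      (Finset.univ.filter fun q : Gamma0Coset N ↦ (T * S) • q = q).card := by
    rw [Nat.card_eq_fintype_card, Fintype.card_subtype]
  have hUδ : finrank ℚ (range (bdryMap N)) + finrank ℚ U = Fintype.card (Gamma0Coset N) := by
    rw [LinearMap.finrank_range_add_finrank_ker, finrank_fintype_fun_eq_card]
  have hε := card_cuspOrbits_le_finrank_range_bdryMap_add_one (N := N)
  set g : U →ₗ[ℚ] Module.Dual ℂ (CuspForm (Gamma0 N) 2) := Ψ.domRestrict U with hg'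
  have hg : finrank ℚ (range g) + finrank ℚ (LinearMap.ker g) = finrank ℚ U :=
    LinearMap.finrank_range_add_finrank_ker g
  have hrange : range g = U.map Ψ := LinearMap.range_domRestrict _ _
  have hker : (relModule N).comap U.subtype ≤ LinearMap.ker g := by
    intro x hx
    rw [LinearMap.mem_ker, LinearMap.domRestrict_apply]
    exact relModule_le_ker_msymbolMap hx
  have hcomap : finrank ℚ (relModule N) = finrank ℚ ((relModule N).comap U.subtype) :=
    (LinearEquiv.finrank_eq (Submodule.comapSubtypeEquivOfLe relModule_le_ker_bdryMap)).symm
  have hRel : finrank ℚ (relModule N) ≤ finrank ℚ (LinearMap.ker g) := by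
    rw [hcomap]; exact Submodule.finrank_mono hker
  have hRel' := finrank_relModule_ge (N := N)
  have hH : finrank ℚ (Submodule.span ℚ (periodHomology N : Set (Module.Dual ℂ (CuspForm (Gamma0 N) 2))))
      ≤ finrank ℚ (range g) := by
    rw [hrange]
    exact Submodule.finrank_mono (Submodule.span_le.mpr periodHomology_le_map_ker)
  have h2 := two_mul_finrank_cuspForm_two_le_finrank_span_periodHomology N
  -- the genus-cum-dimension formula
  have h := h₁ (Gamma0_is_congruence N)
  rw [adjoinNegI_gamma0, ellipticPointCount_two_gamma0_eq_card,
    ellipticPointCount_three_gamma0_eq_card] at h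
  rw [hμ] at h
  rw [hε₂, hε₃] at h
  -- all inequalities are equalities: `finrank (ker g) = finrank Rel`
  have hfin : finrank ℚ ((relModule N).comap U.subtype) = finrank ℚ (LinearMap.ker g) := by
    rw [← hcomap]
    omega
  have heq : (relModule N).comap U.subtype = LinearMap.ker g := Submodule.eq_of_le_of_finrank_eq hker hfin
  -- translate back
  apply le_antisymm
  · intro x hx
    rw [Submodule.mem_inf, LinearMap.mem_ker] at hx
    have hxU : x ∈ U := hx.2
    have hxg : (⟨x, hxU⟩ : U) ∈ LinearMap.ker g := by
      rw [LinearMap.mem_ker, hg', LinearMap.domRestrict_apply]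
      exact hx.1
    rw [← heq, Submodule.mem_comap, Submodule.subtype_apply] at hxg
    exact hxg
  · exact le_inf relModule_le_ker_msymbolMap relModule_le_ker_bdryMap

/-- **The image of the cycles is exactly the rational period homology**: `Ψ(ker δ) = ℚ·H` (given the genus
formula) — every rational cycle of M-symbols integrates to a rational combination of period functionals
`{∞, γ∞}`, and conversely (`periodHomology_le_map_ker`). [cite: Manin1972, Thm. 1.9]
[cite: CremonaAlgorithms1997, §2.1 Thm. 2.1.2] -/
theorem map_ker_bdryMap_eq_span_periodHomology (h₁ : twelve_mul_finrank_cuspForm_two (Gamma0 N)) :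
    (LinearMap.ker (bdryMap N)).map (msymbolMap N) =
      Submodule.span ℚ (periodHomology N : Set (Module.Dual ℂ (CuspForm (Gamma0 N) 2))) := by
  set U : Submodule ℚ (Gamma0Coset N → ℚ) := LinearMap.ker (bdryMap N) with hU
  set Ψ := msymbolMap N with hΨ
  have hμ : (Gamma0 N).index = Fintype.card (Gamma0Coset N) := by
    rw [Subgroup.index, Nat.card_eq_fintype_card]
  have hε₂ : Nat.card {q : SL(2, ℤ) ⧸ Gamma0 N // S • q = q} =
      (Finset.univ.filter fun q : Gamma0Coset N ↦ S • q = q).card := by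
    rw [Nat.card_eq_fintype_card, Fintype.card_subtype]
  have hε₃ : Nat.card {q : SL(2, ℤ) ⧸ Gamma0 N // (T * S) • q = q} =
      (Finset.univ.filter fun q : Gamma0Coset N ↦ (T * S) • q = q).card := by
    rw [Nat.card_eq_fintype_card, Fintype.card_subtype]
  have hUδ : finrank ℚ (range (bdryMap N)) + finrank ℚ U = Fintype.card (Gamma0Coset N) := by
    rw [LinearMap.finrank_range_add_finrank_ker, finrank_fintype_fun_eq_card]
  have hε := card_cuspOrbits_le_finrank_range_bdryMap_add_one (N := N)
  set g : U →ₗ[ℚ] Module.Dual ℂ (CuspForm (Gamma0 N) 2) := Ψ.domRestrict U with hg'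
  have hg : finrank ℚ (range g) + finrank ℚ (LinearMap.ker g) = finrank ℚ U :=
    LinearMap.finrank_range_add_finrank_ker g
  have hrange : range g = U.map Ψ := LinearMap.range_domRestrict _ _
  have hker : (relModule N).comap U.subtype ≤ LinearMap.ker g := by
    intro x hx
    rw [LinearMap.mem_ker, LinearMap.domRestrict_apply]
    exact relModule_le_ker_msymbolMap hx
  have hcomap : finrank ℚ (relModule N) = finrank ℚ ((relModule N).comap U.subtype) :=
    (LinearEquiv.finrank_eq (Submodule.comapSubtypeEquivOfLe relModule_le_ker_bdryMap)).symm
  have hRel : finrank ℚ (relModule N) ≤ finrank ℚ (LinearMap.ker g) := by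
    rw [hcomap]; exact Submodule.finrank_mono hker
  have hRel' := finrank_relModule_ge (N := N)
  have hle : Submodule.span ℚ (periodHomology N : Set (Module.Dual ℂ (CuspForm (Gamma0 N) 2))) ≤ range g := by
    rw [hrange]
    exact Submodule.span_le.mpr periodHomology_le_map_ker
  have hH := Submodule.finrank_mono hle
  have h2 := two_mul_finrank_cuspForm_two_le_finrank_span_periodHomology N
  have h := h₁ (Gamma0_is_congruence N)
  rw [adjoinNegI_gamma0, ellipticPointCount_two_gamma0_eq_card,
    ellipticPointCount_three_gamma0_eq_card] at h
  rw [hμ] at h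
  rw [hε₂, hε₃] at h
  have hfin : finrank ℚ (Submodule.span ℚ (periodHomology N : Set (Module.Dual ℂ (CuspForm (Gamma0 N) 2)))) =
      finrank ℚ (range g) := by
    omega
  rw [← hrange]
  exact (Submodule.eq_of_le_of_finrank_eq hle hfin).symm

end Exact

end Literature.NumberTheory.EllipticCurves.ModularForms

end
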